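import Summits.Ventures.GridStability.Models.InverterDroopFirstOrderCCT

/-!
# GridStability/Models/InverterDroopFirstOrderCCTLossy — the exact clearing-time dichotomy of the first-order droop GFM survives a RESISTIVE coupling (printed lossy power map (II-30)): the impedance angle shifts both equilibria and cancels in `t_cc`

Cell `gridfusion` (LADDER-GRIDFUSION rung G3.a; seat gridfusion-model-3 (g9); models/MODEL-3-NOTES.md §1
(P23), LOW tail of #106-cand). [cite: Qoria2020, eq. (II-30)] prints the quasi-static active power of a
voltage source `V_m∠δ` behind `R_c + jX_c` feeding `V_g∠0`: `p = V_g/(R_c²+X_c²)·[R_c(V_m cos δ − V_g)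
+ X_c V_m sin δ]` = the tree's `InverterDroop.pLossy` (p459453); §V.3 itself neglects the resistance
((V-13), `X ≫ R`). With an impedance angle `φ` such that `R_c = Z sin φ`, `X_c = Z cos φ` (`Z > 0`; the
cell's A1 convention: a rational circle point for `φ`), the printed map is a SHIFTED SINE,
`p = (V_g V_m/Z) sin(δ + φ) − V_g² sin φ/Z` (`pLossy_eq_shifted_sin`), so the first-order droop model
`δ̇ = k_i(p* − pLossy δ)` is the model of `InverterDroopFirstOrderCCT` in the shifted angle `δ + φ` with
the shifted set-point `p* + V_g² sin φ/Z` and `P_max = V_g V_m/Z` (`lossy_isFirstOrderSolutionOn_shift`).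

WHAT IS CERTIFIED (kernel, 0 kit): with `σ`-angle `δ₀′ ∈ (0, π/2)`, `(V_gV_m/Z) sin δ₀′ = p* + V_g² sin φ/Z`
(so the operating point is `δ₀ = δ₀′ − φ` and the unstable one `π − δ₀′ − φ`): cleared at
`δ_c ∈ (δ₀′ − φ, π − δ₀′ − φ)` every post-fault motion returns to `δ₀′ − φ` (`lossy_return`); cleared in
`(π − δ₀′ − φ, 2π + δ₀′ − φ)` it pole-slips to `2π + δ₀′ − φ` (`lossy_poleSlip`); with the bolted-fault
drift `δ₀ + k_i p* t` ((V-26), fault at the converter terminal, `p_mes ≡ 0`) the critical clearing time is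
EXACTLY `t_cc = (π − 2δ₀′)/(k_i p*)` — the impedance angle CANCELS, resistance acts only through
`sin δ₀′ = (p* Z + V_g² sin φ)/(V_g V_m)` (`lossy_cct_exact`). THREE COLUMNS: CERTIFIED statements about
MODEL M_droop1 with the printed lossy quasi-static map; MODELLED: inertial effect neglected, fault read as
`p_mes ≡ 0`, no limiter; the resistive reading is the cell's extension (the print's §V.3 is lossless) —
VALIDATED: nothing juxtaposed. Nothing here says a converter is stable.
-/

noncomputable section

open Real Set Filter Topology
open Summit.Ventures.GridStability.Models.ScalarFlow

namespace Summit.Ventures.GridStability.Models.InverterDroop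

/-- **(II-30) is a shifted sine.** With `R_c = Z sin φ`, `X_c = Z cos φ`, `Z ≠ 0`:
`pLossy V_m V_g R_c X_c δ = (V_g V_m/Z) sin(δ + φ) − V_g² sin φ/Z`. -/
theorem pLossy_eq_shifted_sin {Vm Vg Rc Xc Z φ : ℝ} (hZ : Z ≠ 0) (hR : Rc = Z * sin φ)
    (hX : Xc = Z * cos φ) (δ : ℝ) :
    pLossy Vm Vg Rc Xc δ = Vg * Vm / Z * sin (δ + φ) - Vg ^ 2 * sin φ / Z := by
  have hZ2 : Rc ^ 2 + Xc ^ 2 = Z ^ 2 := by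
    rw [hR, hX]; nlinarith [sin_sq_add_cos_sq φ]
  unfold pLossy
  rw [hZ2, sin_add, hR, hX]
  field_simp
  ring

namespace ReducedParams

variable (P : ReducedParams)

/-- First-order droop model with the printed LOSSY quasi-static map (II-30):
`δ̇ = ω_b(ω_set − ω_e) + k_i (p* − pLossy V_m V_g R_c X_c δ)` [cite: Qoria2020, eqs. (II-30), (V-17)]
(the cell's resistive extension of §V.3's model; `P.Pmax` is not used). -/
def dδFirstOrderLossy (Vm Vg Rc Xc δ : ℝ) : ℝ :=
  P.ωb * (P.ωset - P.ωe) + P.ki * (P.pref - pLossy Vm Vg Rc Xc δ)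

/-- The shifted record: set-point `p* + V_g² sin φ/Z`, `P_max = V_g V_m/Z`. -/
def lossyShift (Vm Vg Z φ : ℝ) : ReducedParams :=
  { P with pref := P.pref + Vg ^ 2 * sin φ / Z, Pmax := Vg * Vm / Z }

/-- The lossy first-order field at `δ` is the lossless first-order field of the shifted record at `δ + φ`. -/
theorem dδFirstOrderLossy_eq {Vm Vg Rc Xc Z φ : ℝ} (hZ : Z ≠ 0) (hR : Rc = Z * sin φ)
    (hX : Xc = Z * cos φ) (δ : ℝ) :
    P.dδFirstOrderLossy Vm Vg Rc Xc δ = (P.lossyShift Vm Vg Z φ).dδFirstOrder (δ + φ) := by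
  simp only [dδFirstOrderLossy, lossyShift, dδFirstOrder, pLossy_eq_shifted_sin hZ hR hX]
  ring

variable {P}

/-- Solutions correspond: `δ` solves the lossy model on `s` iff `δ + φ` solves the shifted lossless model. -/
theorem lossy_isFirstOrderSolutionOn_shift {Vm Vg Rc Xc Z φ : ℝ} (hZ : Z ≠ 0) (hR : Rc = Z * sin φ)
    (hX : Xc = Z * cos φ) {δ : ℝ → ℝ} {s : Set ℝ}
    (hδ : ∀ t ∈ s, HasDerivWithinAt δ (P.dδFirstOrderLossy Vm Vg Rc Xc (δ t)) s t) :
    (P.lossyShift Vm Vg Z φ).IsFirstOrderSolutionOn (fun t => δ t + φ) s := by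
  intro t ht
  have := (hδ t ht).add_const φ
  rwa [P.dδFirstOrderLossy_eq hZ hR hX] at this

/-- **Return (lossy).** `ω_set = ω_e`, `k_i > 0`, `V_g V_m/Z > 0`, `δ₀′ ∈ [−π/2, π/2]` with
`(V_gV_m/Z) sin δ₀′ = p* + V_g² sin φ/Z`: cleared at `δ(0) ∈ (δ₀′ − φ, π − δ₀′ − φ)`, every motion of the
lossy first-order model on `[0, ∞)` tends to the operating angle `δ₀′ − φ`. -/
theorem lossy_return (hω : P.ωset = P.ωe) (hk : 0 < P.ki) {Vm Vg Rc Xc Z φ : ℝ} (hZ : Z ≠ 0)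
    (hR : Rc = Z * sin φ) (hX : Xc = Z * cos φ) (hA : 0 < Vg * Vm / Z)
    {δ₀' : ℝ} (hδ₀ : δ₀' ∈ Icc (-(π / 2)) (π / 2))
    (heq : Vg * Vm / Z * sin δ₀' = P.pref + Vg ^ 2 * sin φ / Z) {δ : ℝ → ℝ}
    (hδ : ∀ t ∈ Ici (0:ℝ), HasDerivWithinAt δ (P.dδFirstOrderLossy Vm Vg Rc Xc (δ t)) (Ici 0) t)
    (hc : δ 0 ∈ Ioo (δ₀' - φ) (π - δ₀' - φ)) :
    Tendsto δ atTop (𝓝 (δ₀' - φ)) := by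
  have h := firstOrder_return (P := P.lossyShift Vm Vg Z φ) hω hk hA hδ₀ heq
    (lossy_isFirstOrderSolutionOn_shift hZ hR hX hδ) ⟨by linarith [hc.1], by linarith [hc.2]⟩
  have := h.2.2.sub_const φ
  simpa using this

/-- **Pole slip (lossy).** Cleared at `δ(0) ∈ (π − δ₀′ − φ, 2π + δ₀′ − φ)`, every motion of the lossy
first-order model increases to `2π + δ₀′ − φ` and stays above `π − δ₀′ − φ`. -/
theorem lossy_poleSlip (hω : P.ωset = P.ωe) (hk : 0 < P.ki) {Vm Vg Rc Xc Z φ : ℝ} (hZ : Z ≠ 0)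
    (hR : Rc = Z * sin φ) (hX : Xc = Z * cos φ) (hA : 0 < Vg * Vm / Z)
    {δ₀' : ℝ} (hδ₀ : δ₀' ∈ Icc (-(π / 2)) (π / 2))
    (heq : Vg * Vm / Z * sin δ₀' = P.pref + Vg ^ 2 * sin φ / Z) {δ : ℝ → ℝ}
    (hδ : ∀ t ∈ Ici (0:ℝ), HasDerivWithinAt δ (P.dδFirstOrderLossy Vm Vg Rc Xc (δ t)) (Ici 0) t)
    (hc : δ 0 ∈ Ioo (π - δ₀' - φ) (2 * π + δ₀' - φ)) :
    (∀ t, 0 ≤ t → π - δ₀' - φ < δ t) ∧ Tendsto δ atTop (𝓝 (2 * π + δ₀' - φ)) := by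
  have h := firstOrder_poleSlip (P := P.lossyShift Vm Vg Z φ) hω hk hA hδ₀ heq
    (lossy_isFirstOrderSolutionOn_shift hZ hR hX hδ) ⟨by linarith [hc.1], by linarith [hc.2]⟩
  refine ⟨fun t ht => ?_, ?_⟩
  · have := (h.1 t ht).1; linarith [hc.1]
  · have := h.2.2.sub_const φ; simpa [add_sub_assoc] using this

/-- **EXACT CCT with a resistive coupling.** `ω_set = ω_e`, `k_i, p* > 0`, `V_gV_m/Z > 0`,
`δ₀′ ∈ (0, π/2)` with `(V_gV_m/Z) sin δ₀′ = p* + V_g² sin φ/Z`; bolted fault at the terminal from the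
operating angle `δ₀′ − φ` (fault-on `faultOn (δ₀′ − φ)`, slope `k_i p*`), lossy post-fault model restarted at
the clearing angle: `t_f < t_cc = (π − 2δ₀′)/(k_i p*)` ⇒ return to `δ₀′ − φ`; `t_cc < t_f` (clearing angle
below `2π + δ₀′ − φ`) ⇒ pole slip — the impedance angle `φ` CANCELS in `t_cc`. -/
theorem lossy_cct_exact (hω : P.ωset = P.ωe) (hk : 0 < P.ki) (hp : 0 < P.pref) {Vm Vg Rc Xc Z φ : ℝ}
    (hZ : Z ≠ 0) (hR : Rc = Z * sin φ) (hX : Xc = Z * cos φ) (hA : 0 < Vg * Vm / Z)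
    {δ₀' : ℝ} (hδ₀ : δ₀' ∈ Ioo 0 (π / 2)) (heq : Vg * Vm / Z * sin δ₀' = P.pref + Vg ^ 2 * sin φ / Z)
    {tf : ℝ} (htf : 0 < tf) {δ : ℝ → ℝ}
    (hδ : ∀ t ∈ Ici (0:ℝ), HasDerivWithinAt δ (P.dδFirstOrderLossy Vm Vg Rc Xc (δ t)) (Ici 0) t)
    (h0 : δ 0 = P.faultOn (δ₀' - φ) tf) :
    (tf < P.tcc δ₀' → Tendsto δ atTop (𝓝 (δ₀' - φ))) ∧
    (P.tcc δ₀' < tf → P.faultOn (δ₀' - φ) tf < 2 * π + δ₀' - φ →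
      (∀ t, 0 ≤ t → π - δ₀' - φ < δ t) ∧ Tendsto δ atTop (𝓝 (2 * π + δ₀' - φ))) := by
  have hkp : 0 < P.ki * P.pref := mul_pos hk hp
  have hδ₀' : δ₀' ∈ Icc (-(π / 2)) (π / 2) := ⟨by linarith [hδ₀.1, pi_pos], hδ₀.2.le⟩
  have hshift : P.faultOn (δ₀' - φ) tf = P.faultOn δ₀' tf - φ := by unfold faultOn; ring
  have hgt : δ₀' - φ < δ 0 := by rw [h0]; unfold faultOn; nlinarith
  constructor
  · intro hlt
    have hup : δ 0 < π - δ₀' - φ := by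
      rw [h0, hshift]; linarith [(P.faultOn_lt_iff hkp δ₀' tf).2 hlt]
    exact lossy_return hω hk hZ hR hX hA hδ₀' heq hδ ⟨hgt, hup⟩
  · intro hlt h2π
    have hlo : π - δ₀' - φ < δ 0 := by
      rw [h0, hshift]; linarith [(P.lt_faultOn_iff hkp δ₀' tf).2 hlt]
    exact lossy_poleSlip hω hk hZ hR hX hA hδ₀' heq hδ ⟨hlo, by rw [h0]; exact h2π⟩

end ReducedParams

end Summit.Ventures.GridStability.Models.InverterDroop

end
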